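import Literature.AnabelianGeometry.Anabelioids.GaloisFiniteColimits
import Literature.AnabelianGeometry.SemiGraphs.GraphOfAnabelioidsLimits
import Literature.AnabelianGeometry.SemiGraphs.GeneralizedPullbackFunctor
import Literature.AnabelianGeometry.SemiGraphs.PullbackFunctor

/-!
# Exactness of the pull-back functors `B(ℋ) ⥤ B(𝒢)` ([SemiAnbd] Remark 2.11.1)

Mochizuki, *Semi-graphs of anabelioids*, Publ. RIMS **42** (2006) 221–322, §2, author's manuscript
p. 32, Remark 2.11.1 [cite: MochizukiSemiAnbd2006, Rem. 2.11.1 p.32]: "every generalized morphism of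
semi-graphs of connected anabelioids `Φ : 𝒢 → ℋ` determines, in a natural fashion, a morphism
`B(𝒢) → B(ℋ)` between the associated anabelioids" (a morphism of anabelioids being an exact functor
in the opposite direction, [GeoAn] Def. 1.1.2).

This file DISCHARGES the named fact `SemiGraphOfAnabelioids.remark_2_11_1_toB` of
`GeneralizedMorphisms.lean` (statement by abc-iut-L3-t1): the pull-back functor
`Φ^* : B(ℋ) ⥤ B(𝒢)` (`GeneralizedHom.pullbackFunctor`, `GeneralizedPullbackFunctor.lean`) — and the
pull-back functor `φ^*` of an ordinary morphism (`Hom.pullbackFunctor`, `PullbackFunctor.lean`) — is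
EXACT.  Proof: finite limits and colimits in `B(𝒢)` are computed componentwise
(`hasLimitsOfShape_bObj`, `hasColimitsOfShape_bObj`, L3-t9; the constituent Galois categories have
finite colimits by `hasColimitsOfShape_of_galoisCategory`), so the restriction functors `ρ_c`
jointly reflect (co)limits (`BObj.isLimit_of_components`); and `Φ^* ⋙ ρ_c = ρ_{Cat(Φ)(c)} ⋙ Φ_c^*`
with `Φ_c^*` exact.  Proof-only (no definitions).
-/

namespace Literature.AnabelianGeometry.SemiGraphs

open CategoryTheory CategoryTheory.Limits
open Literature.AnabelianGeometry.Anabelioids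

universe v₁ u₁ u

namespace SemiGraphOfAnabelioids

variable {𝒢 ℋ : SemiGraphOfAnabelioids.{v₁, u₁, u}}

/-! ### Isomorphisms and (co)limits in `B(𝒢)` are detected componentwise -/

/-- A morphism of `B(𝒢)` all of whose components are isomorphisms is an isomorphism.
[cite: MochizukiSemiAnbd2006, Def. 2.1 p.23] -/
theorem BObj.isIso_of_components {A B : 𝒢.BObj} (g : A ⟶ B) (hS : ∀ v, IsIso (g.fS v))
    (hT : ∀ e, IsIso (g.fT e)) : IsIso g := by
  let h : B ⟶ A :=
    { fS := fun v => inv (g.fS v)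
      fT := fun e => inv (g.fT e)
      comm := fun b v hb => by
        rw [Functor.map_inv, IsIso.inv_comp_eq, ← Category.assoc, g.comm b v hb, Category.assoc,
          IsIso.hom_inv_id, Category.comp_id] }
  refine ⟨⟨h, ?_, ?_⟩⟩
  · exact BObj.hom_ext _ _ (funext fun v => IsIso.hom_inv_id (g.fS v))
      (funext fun e => IsIso.hom_inv_id (g.fT e))
  · exact BObj.hom_ext _ _ (funext fun v => IsIso.inv_hom_id (g.fS v))
      (funext fun e => IsIso.inv_hom_id (g.fT e))

variable (𝒢) in
/-- The restriction functors `ρ_c : B(𝒢) ⥤ 𝒢_c` preserve finite limits.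
[cite: MochizukiSemiAnbd2006, Def. 2.1 p.23] -/
theorem ρC_preservesLimitsOfShape (J : Type) [SmallCategory J] [FinCategory J]
    (c : 𝒢.graph.CatCarrier) : PreservesLimitsOfShape J (𝒢.ρC c) := by
  obtain ⟨-, hρ, hρE⟩ := 𝒢.hasLimitsOfShape_bObj (J := J)
  cases c with
  | inl w => exact hρ w
  | inr f => exact hρE f

variable (𝒢) in
/-- The restriction functors `ρ_c : B(𝒢) ⥤ 𝒢_c` preserve finite colimits.
[cite: MochizukiSemiAnbd2006, Def. 2.1 p.23] -/
theorem ρC_preservesColimitsOfShape (J : Type) [SmallCategory J] [FinCategory J]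
    (c : 𝒢.graph.CatCarrier) : PreservesColimitsOfShape J (𝒢.ρC c) := by
  haveI : ∀ v, HasColimitsOfShape J (𝒢.V v) := fun v => hasColimitsOfShape_of_galoisCategory _ J
  haveI : ∀ e, HasColimitsOfShape J (𝒢.E e) := fun e => hasColimitsOfShape_of_galoisCategory _ J
  obtain ⟨-, hρ, hρE⟩ := 𝒢.hasColimitsOfShape_bObj (J := J)
  cases c with
  | inl w => exact hρ w
  | inr f => exact hρE f

/-- **Limits in `B(𝒢)` are detected componentwise**: a cone over a finite diagram in `B(𝒢)` whose
images under all restriction functors `ρ_c` are limit cones is a limit cone.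
[cite: MochizukiSemiAnbd2006, Def. 2.1 p.23] -/
theorem BObj.isLimit_of_components {J : Type} [SmallCategory J] [FinCategory J] {K : J ⥤ 𝒢.BObj}
    (s : Cone K) (hs : ∀ c : 𝒢.graph.CatCarrier, Nonempty (IsLimit ((𝒢.ρC c).mapCone s))) :
    Nonempty (IsLimit s) := by
  obtain ⟨hJ, -, -⟩ := 𝒢.hasLimitsOfShape_bObj (J := J)
  haveI : ∀ c, PreservesLimitsOfShape J (𝒢.ρC c) := 𝒢.ρC_preservesLimitsOfShape J
  let f : s ⟶ limit.cone K := (limit.isLimit K).liftConeMorphism s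
  have hf : ∀ c : 𝒢.graph.CatCarrier, IsIso ((𝒢.ρC c).map f.hom) := by
    intro c
    have h1 := IsLimit.hom_isIso (hs c).some (isLimitOfPreserves (𝒢.ρC c) (limit.isLimit K))
      ((Cone.functoriality K (𝒢.ρC c)).map f)
    exact ((Cone.forget _).mapIso
      (@asIso _ _ _ _ ((Cone.functoriality K (𝒢.ρC c)).map f) h1)).isIso_hom
  haveI : IsIso f.hom :=
    BObj.isIso_of_components f.hom (fun v => hf (Sum.inl v)) (fun e => hf (Sum.inr e))
  haveI : IsIso f := Cone.cone_iso_of_hom_iso f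
  exact ⟨(limit.isLimit K).ofIsoLimit (asIso f).symm⟩

/-- **Colimits in `B(𝒢)` are detected componentwise**: a cocone under a finite diagram in `B(𝒢)`
whose images under all restriction functors `ρ_c` are colimit cocones is a colimit cocone.
[cite: MochizukiSemiAnbd2006, Def. 2.1 p.23] -/
theorem BObj.isColimit_of_components {J : Type} [SmallCategory J] [FinCategory J] {K : J ⥤ 𝒢.BObj}
    (s : Cocone K) (hs : ∀ c : 𝒢.graph.CatCarrier, Nonempty (IsColimit ((𝒢.ρC c).mapCocone s))) :
    Nonempty (IsColimit s) := by
  haveI : ∀ v, HasColimitsOfShape J (𝒢.V v) := fun v => hasColimitsOfShape_of_galoisCategory _ J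
  haveI : ∀ e, HasColimitsOfShape J (𝒢.E e) := fun e => hasColimitsOfShape_of_galoisCategory _ J
  obtain ⟨hJ, -, -⟩ := 𝒢.hasColimitsOfShape_bObj (J := J)
  haveI : ∀ c, PreservesColimitsOfShape J (𝒢.ρC c) := 𝒢.ρC_preservesColimitsOfShape J
  let f : colimit.cocone K ⟶ s := (colimit.isColimit K).descCoconeMorphism s
  have hf : ∀ c : 𝒢.graph.CatCarrier, IsIso ((𝒢.ρC c).map f.hom) := by
    intro c
    have h1 := IsColimit.hom_isIso (isColimitOfPreserves (𝒢.ρC c) (colimit.isColimit K))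
      (hs c).some ((Cocone.functoriality K (𝒢.ρC c)).map f)
    exact ((Cocone.forget _).mapIso
      (@asIso _ _ _ _ ((Cocone.functoriality K (𝒢.ρC c)).map f) h1)).isIso_hom
  haveI : IsIso f.hom :=
    BObj.isIso_of_components f.hom (fun v => hf (Sum.inl v)) (fun e => hf (Sum.inr e))
  haveI : IsIso f := Cocone.cocone_iso_of_hom_iso f
  exact ⟨(colimit.isColimit K).ofIsoColimit (asIso f)⟩

/-! ### Exactness of the pull-back functors -/

namespace GeneralizedHom

variable (Φ : GeneralizedHom 𝒢 ℋ)

/-- The pull-back functor `Φ^* : B(ℋ) ⥤ B(𝒢)` of a generalized morphism preserves finite limits.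
[cite: MochizukiSemiAnbd2006, Rem. 2.11.1 p.32] -/
theorem pullbackFunctor_preservesFiniteLimits : PreservesFiniteLimits Φ.pullbackFunctor := by
  refine ⟨fun J _ _ => ⟨fun {K} => ⟨fun {c} hc => ?_⟩⟩⟩
  haveI : ∀ d, PreservesLimitsOfShape J (ℋ.ρC d) := ℋ.ρC_preservesLimitsOfShape J
  refine BObj.isLimit_of_components _ (fun d => ?_)
  cases d with
  | inl v =>
    exact ⟨by
      change IsLimit ((ℋ.ρC (Φ.functor.obj (Sum.inl v)) ⋙ (Φ.φ (Sum.inl v)).pullback).mapCone c)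
      exact isLimitOfPreserves _ hc⟩
  | inr e =>
    exact ⟨by
      change IsLimit ((ℋ.ρC (Φ.functor.obj (Sum.inr e)) ⋙ (Φ.φ (Sum.inr e)).pullback).mapCone c)
      exact isLimitOfPreserves _ hc⟩

/-- The pull-back functor `Φ^* : B(ℋ) ⥤ B(𝒢)` of a generalized morphism preserves finite colimits.
[cite: MochizukiSemiAnbd2006, Rem. 2.11.1 p.32] -/
theorem pullbackFunctor_preservesFiniteColimits : PreservesFiniteColimits Φ.pullbackFunctor := by
  refine ⟨fun J _ _ => ⟨fun {K} => ⟨fun {c} hc => ?_⟩⟩⟩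
  haveI : ∀ d, PreservesColimitsOfShape J (ℋ.ρC d) := ℋ.ρC_preservesColimitsOfShape J
  refine BObj.isColimit_of_components _ (fun d => ?_)
  cases d with
  | inl v =>
    exact ⟨by
      change IsColimit ((ℋ.ρC (Φ.functor.obj (Sum.inl v)) ⋙ (Φ.φ (Sum.inl v)).pullback).mapCocone c)
      exact isColimitOfPreserves _ hc⟩
  | inr e =>
    exact ⟨by
      change IsColimit
        ((ℋ.ρC (Φ.functor.obj (Sum.inr e)) ⋙ (Φ.φ (Sum.inr e)).pullback).mapCocone c)
      exact isColimitOfPreserves _ hc⟩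

/-- **[SemiAnbd] Remark 2.11.1**: the morphism of anabelioids `B(𝒢) → B(ℋ)` determined by a
generalized morphism `Φ : 𝒢 → ℋ` — the exact pull-back functor `Φ^* : B(ℋ) ⥤ₑ B(𝒢)`.
[cite: MochizukiSemiAnbd2006, Rem. 2.11.1 p.32] -/
theorem nonempty_anabelioidsHom (Φ : GeneralizedHom 𝒢 ℋ) :
    Nonempty (Anabelioids.Hom 𝒢.BObj ℋ.BObj) :=
  haveI := Φ.pullbackFunctor_preservesFiniteLimits
  haveI := Φ.pullbackFunctor_preservesFiniteColimits
  ⟨ExactFunctor.of Φ.pullbackFunctor⟩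

end GeneralizedHom

/-- DISCHARGE of `remark_2_11_1_toB` ([SemiAnbd] Remark 2.11.1, second sentence): every generalized
morphism of semi-graphs of anabelioids `Φ : 𝒢 → ℋ` determines a morphism of anabelioids
`B(𝒢) → B(ℋ)`, namely the exact functor `Φ^* : B(ℋ) ⥤ₑ B(𝒢)`.
[cite: MochizukiSemiAnbd2006, Rem. 2.11.1 p.32] -/
theorem remark_2_11_1_toB_holds : remark_2_11_1_toB.{v₁, u₁, u} :=
  fun _ _ Φ => Φ.nonempty_anabelioidsHom

namespace Hom

variable (φ : Hom 𝒢 ℋ)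

/-- The pull-back functor `φ^* : B(ℋ) ⥤ B(𝒢)` of a morphism of semi-graphs of anabelioids preserves
finite limits. [cite: MochizukiSemiAnbd2006, Rem. 2.11.1 p.32] -/
theorem pullbackFunctor_preservesFiniteLimits : PreservesFiniteLimits φ.pullbackFunctor := by
  refine ⟨fun J _ _ => ⟨fun {K} => ⟨fun {c} hc => ?_⟩⟩⟩
  obtain ⟨-, hρ, hρE⟩ := ℋ.hasLimitsOfShape_bObj (J := J)
  haveI := hρ
  haveI := hρE
  refine BObj.isLimit_of_components _ (fun d => ?_)
  cases d with
  | inl v =>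
    exact ⟨by
      change IsLimit ((ℋ.ρ (φ.base.vertexMap v) ⋙ (φ.φV v).pullback).mapCone c)
      exact isLimitOfPreserves _ hc⟩
  | inr e =>
    exact ⟨by
      change IsLimit
        ((ℋ.ρE (φ.base.edgeMap e) ⋙ (φ.φE e (φ.base.edgeMap e) rfl).pullback).mapCone c)
      exact isLimitOfPreserves _ hc⟩

/-- The pull-back functor `φ^* : B(ℋ) ⥤ B(𝒢)` of a morphism of semi-graphs of anabelioids preserves
finite colimits. [cite: MochizukiSemiAnbd2006, Rem. 2.11.1 p.32] -/
theorem pullbackFunctor_preservesFiniteColimits : PreservesFiniteColimits φ.pullbackFunctor := by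
  refine ⟨fun J _ _ => ⟨fun {K} => ⟨fun {c} hc => ?_⟩⟩⟩
  haveI : ∀ v, HasColimitsOfShape J (ℋ.V v) := fun v => hasColimitsOfShape_of_galoisCategory _ J
  haveI : ∀ e, HasColimitsOfShape J (ℋ.E e) := fun e => hasColimitsOfShape_of_galoisCategory _ J
  obtain ⟨-, hρ, hρE⟩ := ℋ.hasColimitsOfShape_bObj (J := J)
  haveI := hρ
  haveI := hρE
  refine BObj.isColimit_of_components _ (fun d => ?_)
  cases d with
  | inl v =>
    exact ⟨by
      change IsColimit ((ℋ.ρ (φ.base.vertexMap v) ⋙ (φ.φV v).pullback).mapCocone c)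
      exact isColimitOfPreserves _ hc⟩
  | inr e =>
    exact ⟨by
      change IsColimit
        ((ℋ.ρE (φ.base.edgeMap e) ⋙ (φ.φE e (φ.base.edgeMap e) rfl).pullback).mapCocone c)
      exact isColimitOfPreserves _ hc⟩

/-- The morphism of anabelioids `B(𝒢) → B(ℋ)` of a morphism `φ : 𝒢 → ℋ` of semi-graphs of
anabelioids: the exact pull-back functor `φ^* : B(ℋ) ⥤ₑ B(𝒢)` ([SemiAnbd] Rmk. 2.11.1 for the
generalized morphism of `φ`, here directly). [cite: MochizukiSemiAnbd2006, Rem. 2.11.1 p.32] -/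
theorem nonempty_anabelioidsHom (φ : Hom 𝒢 ℋ) : Nonempty (Anabelioids.Hom 𝒢.BObj ℋ.BObj) :=
  haveI := φ.pullbackFunctor_preservesFiniteLimits
  haveI := φ.pullbackFunctor_preservesFiniteColimits
  ⟨ExactFunctor.of φ.pullbackFunctor⟩

end Hom

end SemiGraphOfAnabelioids

end Literature.AnabelianGeometry.SemiGraphs
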